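import Literature.NumberTheory.Automorphic.ProModularDeRhamClassicalGL2QOddPrime
import Literature.NumberTheory.Automorphic.FontaineMazurGL2DyadicNonsolvable
import Literature.NumberTheory.GaloisRepresentations.ResidualRepScalarExtension
import Literature.NumberTheory.GaloisRepresentations.CalegariEvenFontaineMazurTwo
import HarnessLib

/-!
# `Pan2022_proModularDeRhamClassical_GL2Q` reduces to its dyadic, residually SOLVABLE instance

Topic `Literature/NumberTheory/Automorphic`; namespace `Literature.NumberTheory.Automorphic`.
A *proofs* file (theorems only; no definition, no named fact, D-0026), sibling of
`ProModularDeRhamClassicalGL2Q` (the named fact `Pan2022_proModularDeRhamClassical_GL2Q`: a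
pro-modular, residually absolutely irreducible, irreducible, almost everywhere unramified, regular
de Rham `ρ : Γ_ℚ → GL₂(ℚ̄_p)` is a Tate twist of the Galois representation of a newform, at EVERY
prime `p`; [Pan2022LocallyAnalyticII, Thm. 1.1.2] with [PaskunasTung2021, Thm. 7.1]) and of
`ProModularDeRhamClassicalGL2QOddPrime` (at odd `p` the fact is a case of
`XZhang2024_fontaineMazurGL2_tateTwist`, a `p`-adically automorphic `ρ` being odd,
`BigHeckeGLn.TameLevel.IsPadicallyAutomorphic.isOdd`; `Pan2022_proModularDeRhamClassical_GL2Q.of_dyadic`).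

Here the dyadic instance is cut down further, to the residually SOLVABLE (= dihedral) case:

* `proModularDeRhamClassical_GL2Q_two_of_not_isSolvable` — **at `p = 2`, for `ρ̄` with
  NON-SOLVABLE image the fact is a case of Tung's theorem** `Tung2020_fontaineMazurGL2_two_tateTwist`
  ([Tung2020, Thm. 1]: "`p = 2`, `ρ` unramified a.e., odd, de Rham with distinct weights, `ρ̄`
  non-solvable and modular ⟹ `ρ` modular up to twist") granted Serre's conjecture at `2` in the
  tree's weak form `exists_newform_of_odd_irreducible` (Khare–Wintenberger–Kisin; for every
  discrete algebraically closed `k` of characteristic `2`).  The glue, all proved in the tree: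
  oddness of `ρ` is automatic (`IsPadicallyAutomorphic.isOdd`); Tung's residual modularity
  hypothesis is discharged over the model `k = \overline{ℤ̄₂/𝔪}` (discrete topology,
  characteristic `2` by `charP_padicAlgClResidueField`) by Serre's conjecture applied to the
  discrete continuous model `τ` of `GL₂(ι) ∘ ρ.residualRep`
  (`FramedGaloisRep.exists_framedGaloisRep_coe_eq_map_residualRep`: continuous with open kernel,
  IRREDUCIBLE because `ρ` is residually absolutely irreducible — Brauer–Nesbitt data and
  "irreducibility is detected by characteristic polynomials"), which is odd because `1 = -1` in
  characteristic `2` (`FramedGaloisRep.isOdd_of_charP_two`).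
* `Pan2022_proModularDeRhamClassical_GL2Q.of_dyadic_solvable` — consequently the named fact
  follows from `XZhang2024_fontaineMazurGL2_tateTwist`, `Tung2020_fontaineMazurGL2_two_tateTwist`,
  Serre's conjecture at `2`, and ITS OWN INSTANCE AT `p = 2` FOR RESIDUALLY SOLVABLE `ρ̄`
  (hypothesis `h2`: the body of the fact at `p = 2` with the extra hypotheses
  `IsSolvable ρ.residualRep.range` and — free, by `isOdd` — `ρ.IsOdd`, in the binder order of the
  consumer crux `Summit.Langlands…DyadicOddResidue.DihedralProModularityCore`/`DyadicDihedralFM`);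
* `Pan2022_proModularDeRhamClassical_GL2Q_iff_dyadic_solvable` — and is EQUIVALENT to that
  instance granted the three facts.

So, for the debt census: modulo named facts of the tree whose printed proofs are independent of
Pan's (X. Zhang 2024 at `p ≥ 3`; Tung 2021 and Khare–Wintenberger–Kisin at `p = 2`), the content
of `Pan2022_proModularDeRhamClassical_GL2Q` is EXACTLY its case "`p = 2`, `ρ̄` absolutely
irreducible with solvable image" — in characteristic `2` this means `ρ̄` dihedral
(`FramedGaloisRep.isDihedralType_residualRep_of_isSolvable_two`; Allen 2014, p. 3: "any absolutely
irreducible, 2-dimensional, mod 2 representation with solvable image is dihedral") — which is the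
one case no other result in print covers in this generality (Kisin 2009 / Khare–Wintenberger /
Paškūnas 2016 / Tung 2021 all assume non-solvable residual image at `p = 2`; Allen 2014 needs
`ρ` nearly ordinary and his condition (5)), and is precisely the instance consumed by the route
`DyadicOddResidue` (glue `DyadicDihedralFMGlue`: `DihedralProModularityCore → ProModularClassicality
→ …`, where `ProModularClassicality` is this fact verbatim).  Nothing here claims that case: it is
[Pan2022LocallyAnalyticII, Thm. 1.1.2] with [PaskunasTung2021, Thm. 7.1] (the `2`-adic dihedral
blocks) and stays recorded as the open content of the named fact.

## References

* L. Pan, arXiv:2209.06366 (2022), Thm. 1.1.2 (= Thm. 7.1.2). [Pan2022LocallyAnalyticII]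
* V. Paškūnas, S.-N. Tung, Forum Math. Sigma 9 (2021) e80, Thm. 7.1. [PaskunasTung2021]
* S.-N. Tung, *On the automorphy of 2-dimensional potentially semistable deformation rings of
  `G_{ℚ_p}`*, Algebra Number Theory 15 (2021) 2173–2194 = arXiv:1803.07451, Thm. 1. [Tung2020]
* C. Khare, J.-P. Wintenberger, Invent. Math. 178 (2009), Thm. 1.2; M. Kisin, Invent. Math. 178
  (2009), Thm. 0.1, Cor. 0.2. [KhareWintenberger2009] [Kisin2009TwoAdic]
* X. Zhang, arXiv:2412.06812 (2024), Thm. 1.0.2. [XZhang2024FontaineMazurP3]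
* P. B. Allen, Compositio Math. 150 (2014), Introduction, p. 3. [Allen2014]
-/

noncomputable section

open scoped MatrixGroups Matrix NumberField ModularForm
open NumberField IsDedekindDomain Field Filter CongruenceSubgroup

namespace Literature.NumberTheory.Automorphic

open Literature.NumberTheory.GaloisRepresentations
open Literature.NumberTheory.EllipticCurves.ModularForms

/-- **At `p = 2`, for residually non-solvable `ρ̄`, "pro-modular + regular de Rham ⟹ classical"
is a case of Tung's theorem plus Serre's conjecture.**  Let `ρ : Γ_ℚ → GL₂(ℚ̄₂)` be continuous,
residually absolutely irreducible with `ρ̄(Γ_ℚ)` NON-SOLVABLE, irreducible, unramified almost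
everywhere, de Rham at `2` with distinct labelled Hodge–Tate weights, and `2`-adically automorphic
of some tame level.  Granted `Tung2020_fontaineMazurGL2_two_tateTwist` and Serre's conjecture at
`2` (`exists_newform_of_odd_irreducible`, every discrete algebraically closed `k` of
characteristic `2`), a Tate twist of `ρ` is the Galois representation of a newform — VERBATIM the
conclusion of `Pan2022_proModularDeRhamClassical_GL2Q` at `p = 2`.  Glue: `ρ` is odd
(`IsPadicallyAutomorphic.isOdd`); over `k = \overline{ℤ̄₂/𝔪}` (discrete, characteristic `2`) the
model `τ` of `GL₂(ι) ∘ ρ̄` (`FramedGaloisRep.exists_framedGaloisRep_coe_eq_map_residualRep`) is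
continuous, irreducible and odd (`FramedGaloisRep.isOdd_of_charP_two`), so Serre's conjecture makes
it modular, which is Tung's residual hypothesis. [cite: Tung2020, Thm. 1]
[cite: KhareWintenberger2009, Thm. 1.2 (with Kisin2009TwoAdic, Thm. 0.1)] -/
theorem proModularDeRhamClassical_GL2Q_two_of_not_isSolvable
    (hT : Tung2020_fontaineMazurGL2_two_tateTwist)
    (hS : ∀ (k : Type) [Field k] [TopologicalSpace k] [DiscreteTopology k],
      exists_newform_of_odd_irreducible (p := 2) (k := k))
    (ρ : FramedGaloisRep ℚ (PadicAlgCl 2) 2) (hres : ρ.IsResiduallyAbsIrreducible)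
    (hirr : ρ.toGaloisRep.IsIrreducible)
    (hunr : ∀ᶠ v : HeightOneSpectrum (𝓞 ℚ) in cofinite, ρ.IsUnramifiedAt v)
    (hdR : ∀ (v : HeightOneSpectrum (𝓞 ℚ)) (hv : ((2 : ℕ) : 𝓞 ℚ) ∈ v.asIdeal),
      (PAdicHodge.fontainePstAdicCompletion v 2 hv).IsDeRhamFramed (ρ.toLocal v) ∧
      ∀ τ : v.adicCompletion ℚ →+* PadicAlgCl 2, Continuous τ →
        (ρ.labelledHodgeTateWeightsAt v (PAdicHodge.fontainePstAdicCompletion v 2 hv).algebra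
          (PAdicHodge.fontainePstAdicCompletion v 2 hv).𝔅 τ).Nodup)
    (haut : ∃ 𝒰 : BigHeckeGLn.TameLevel 2 ℚ 2, 𝒰.IsPadicallyAutomorphic ρ)
    (hns : ¬ IsSolvable ρ.residualRep.range) :
    ∃ (χ : absoluteGaloisGroup ℚ →ₜ* (PadicAlgCl 2)ˣ) (m : ℤ),
      (∀ σ, χ σ = cyclotomicPadicAlgCl ℚ 2 σ ^ m) ∧
      ∃ (N : ℕ) (_ : NeZero N) (k : ℤ) (f : CuspForm (Gamma1 N) k)
        (ιf : coeffCharField f →+* PadicAlgCl 2),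
        IsNewform1 f ∧ IsGaloisRepOfNewform1 f ιf {q | q ∣ N * 2} (FramedRep.twist ρ χ) := by
  obtain ⟨𝒰, h𝒰⟩ := haut
  have hodd : ρ.IsOdd := BigHeckeGLn.TameLevel.IsPadicallyAutomorphic.isOdd 𝒰 h𝒰
  -- the model `k = \overline{ℤ̄₂/𝔪}` with the discrete topology
  let k : Type := AlgebraicClosure (padicAlgClResidueField 2)
  letI : TopologicalSpace k := ⊥
  haveI : DiscreteTopology k := ⟨rfl⟩
  haveI : CharP k 2 := by
    haveI : CharP (padicAlgClResidueField 2) 2 := charP_padicAlgClResidueField 2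
    exact (Algebra.charP_iff (padicAlgClResidueField 2) k 2).mp inferInstance
  -- the discrete continuous model `τ` of `GL₂(ι) ∘ ρ̄`: irreducible (residual absolute
  -- irreducibility) and odd (characteristic `2`), hence modular by Serre's conjecture
  obtain ⟨τ, hτ, hirrτ, -⟩ := ρ.exists_framedGaloisRep_coe_eq_map_residualRep hres
    (algebraMap (padicAlgClResidueField 2) k)
  have hmod := hS k τ hirrτ (FramedGaloisRep.isOdd_of_charP_two τ)
  exact hT ρ hunr hirr hodd hdR hns k (algebraMap (padicAlgClResidueField 2) k) τ hτ hmod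

/-- **`Pan2022_proModularDeRhamClassical_GL2Q` = odd-prime Fontaine–Mazur + Tung + Serre at `2`
+ its own dyadic residually-solvable instance.**  The named fact follows from
`XZhang2024_fontaineMazurGL2_tateTwist` (odd `p`), `Tung2020_fontaineMazurGL2_two_tateTwist` and
Serre's conjecture at `2` (`p = 2`, `ρ̄` non-solvable), and the statement of the fact at `p = 2`
for `ρ̄` with SOLVABLE image (hypothesis `h2`; in characteristic `2`, absolutely irreducible with
solvable image = dihedral, `FramedGaloisRep.isDihedralType_residualRep_of_isSolvable_two`), where
`h2` may moreover assume `ρ` odd (free: `IsPadicallyAutomorphic.isOdd`) — the binder order is that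
of the consumer crux `DihedralProModularityCore` of route `DyadicOddResidue`.  So the content of
the fact beyond those three is exactly [Pan2022LocallyAnalyticII, Thm. 1.1.2] with
[PaskunasTung2021, Thm. 7.1] in the `2`-adic residually dihedral case.
[cite: Pan2022LocallyAnalyticII, Thm. 1.1.2 (= Thm. 7.1.2)] [cite: PaskunasTung2021, Thm. 7.1]
[cite: Tung2020, Thm. 1] [cite: XZhang2024FontaineMazurP3, Thm. 1.0.2] -/
theorem Pan2022_proModularDeRhamClassical_GL2Q.of_dyadic_solvable
    (hX : XZhang2024_fontaineMazurGL2_tateTwist) (hT : Tung2020_fontaineMazurGL2_two_tateTwist)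
    (hS : ∀ (k : Type) [Field k] [TopologicalSpace k] [DiscreteTopology k],
      exists_newform_of_odd_irreducible (p := 2) (k := k))
    (h2 : ∀ (ρ : FramedGaloisRep ℚ (PadicAlgCl 2) 2),
      ρ.IsResiduallyAbsIrreducible → IsSolvable ρ.residualRep.range →
      ρ.toGaloisRep.IsIrreducible → ρ.IsOdd →
      (∀ᶠ v : HeightOneSpectrum (𝓞 ℚ) in cofinite, ρ.IsUnramifiedAt v) →
      (∀ (v : HeightOneSpectrum (𝓞 ℚ)) (hv : ((2 : ℕ) : 𝓞 ℚ) ∈ v.asIdeal),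
        (PAdicHodge.fontainePstAdicCompletion v 2 hv).IsDeRhamFramed (ρ.toLocal v) ∧
        ∀ τ : v.adicCompletion ℚ →+* PadicAlgCl 2, Continuous τ →
          (ρ.labelledHodgeTateWeightsAt v (PAdicHodge.fontainePstAdicCompletion v 2 hv).algebra
            (PAdicHodge.fontainePstAdicCompletion v 2 hv).𝔅 τ).Nodup) →
      (∃ 𝒰 : BigHeckeGLn.TameLevel 2 ℚ 2, 𝒰.IsPadicallyAutomorphic ρ) →
      ∃ (χ : absoluteGaloisGroup ℚ →ₜ* (PadicAlgCl 2)ˣ) (m : ℤ),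
        (∀ σ, χ σ = cyclotomicPadicAlgCl ℚ 2 σ ^ m) ∧
        ∃ (N : ℕ) (_ : NeZero N) (k : ℤ) (f : CuspForm (Gamma1 N) k)
          (ιf : coeffCharField f →+* PadicAlgCl 2),
          IsNewform1 f ∧ IsGaloisRepOfNewform1 f ιf {q | q ∣ N * 2} (FramedRep.twist ρ χ)) :
    Pan2022_proModularDeRhamClassical_GL2Q := by
  refine Pan2022_proModularDeRhamClassical_GL2Q.of_dyadic hX fun ρ hres hirr hunr hdR haut => ?_
  by_cases hsol : IsSolvable ρ.residualRep.range
  · obtain ⟨𝒰, h𝒰⟩ := haut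
    exact h2 ρ hres hsol hirr (BigHeckeGLn.TameLevel.IsPadicallyAutomorphic.isOdd 𝒰 h𝒰) hunr hdR
      ⟨𝒰, h𝒰⟩
  · exact proModularDeRhamClassical_GL2Q_two_of_not_isSolvable hT hS ρ hres hirr hunr hdR haut hsol

/-- **Granted X. Zhang (odd `p`), Tung and Serre (at `2`), the named fact
`Pan2022_proModularDeRhamClassical_GL2Q` is EQUIVALENT to its dyadic residually-solvable
instance** (`Pan2022_proModularDeRhamClassical_GL2Q.of_dyadic_solvable` and specialisation).
[cite: Pan2022LocallyAnalyticII, Thm. 1.1.2 (= Thm. 7.1.2)] [cite: PaskunasTung2021, Thm. 7.1] -/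
theorem Pan2022_proModularDeRhamClassical_GL2Q_iff_dyadic_solvable
    (hX : XZhang2024_fontaineMazurGL2_tateTwist) (hT : Tung2020_fontaineMazurGL2_two_tateTwist)
    (hS : ∀ (k : Type) [Field k] [TopologicalSpace k] [DiscreteTopology k],
      exists_newform_of_odd_irreducible (p := 2) (k := k)) :
    Pan2022_proModularDeRhamClassical_GL2Q ↔
      ∀ (ρ : FramedGaloisRep ℚ (PadicAlgCl 2) 2),
        ρ.IsResiduallyAbsIrreducible → IsSolvable ρ.residualRep.range →
        ρ.toGaloisRep.IsIrreducible → ρ.IsOdd →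
        (∀ᶠ v : HeightOneSpectrum (𝓞 ℚ) in cofinite, ρ.IsUnramifiedAt v) →
        (∀ (v : HeightOneSpectrum (𝓞 ℚ)) (hv : ((2 : ℕ) : 𝓞 ℚ) ∈ v.asIdeal),
          (PAdicHodge.fontainePstAdicCompletion v 2 hv).IsDeRhamFramed (ρ.toLocal v) ∧
          ∀ τ : v.adicCompletion ℚ →+* PadicAlgCl 2, Continuous τ →
            (ρ.labelledHodgeTateWeightsAt v (PAdicHodge.fontainePstAdicCompletion v 2 hv).algebra
              (PAdicHodge.fontainePstAdicCompletion v 2 hv).𝔅 τ).Nodup) →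
        (∃ 𝒰 : BigHeckeGLn.TameLevel 2 ℚ 2, 𝒰.IsPadicallyAutomorphic ρ) →
        ∃ (χ : absoluteGaloisGroup ℚ →ₜ* (PadicAlgCl 2)ˣ) (m : ℤ),
          (∀ σ, χ σ = cyclotomicPadicAlgCl ℚ 2 σ ^ m) ∧
          ∃ (N : ℕ) (_ : NeZero N) (k : ℤ) (f : CuspForm (Gamma1 N) k)
            (ιf : coeffCharField f →+* PadicAlgCl 2),
            IsNewform1 f ∧ IsGaloisRepOfNewform1 f ιf {q | q ∣ N * 2} (FramedRep.twist ρ χ) :=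
  ⟨fun h ρ hres _ hirr _ hunr hdR haut => h 2 ρ hres hirr hunr hdR haut,
    fun h2 => Pan2022_proModularDeRhamClassical_GL2Q.of_dyadic_solvable hX hT hS h2⟩

end Literature.NumberTheory.Automorphic

end
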